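import Literature.Topology.FourManifolds.ConcordanceStripReplacement
import HarnessLib

/-!
# Replacing a strip of a conical concordance by a surface inside a good tube

Topic `Literature/Topology/FourManifolds`; sequel of `ConcordanceStripReplacement.lean` in the
proof programme of the Fox–Milnor fact
`Literature.Topology.FourManifolds.Knot.exists_isConnectedSum_isConcordant` (the connected sum of
two concordances, `BandSumConcordance.lean`). Everything here is proved; no named fact is
introduced.

`ConcordanceStripReplacement.lean` turns the good tube of a conical concordance
(`Knot.IsConicalConcordance.exists_goodTube`) into a machine producing new concordances from a
**detour** of the core curve in tube coordinates, `u ↦ (κθ u, κd u)` (`StripFrame.Detour`): the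
new lift is `(u, t) ↦ tube ((κθ u, t), κd u)`, the *same* curve at all times. That suffices for
the one-sided congruence (a concordance of the first factor, band-summed with a *fixed* small copy
of the second factor, `BandSumConcordanceLeftProofs.lean`). The two-sided statement (both factors
move) needs the inserted object to vary with the time as well, and its time coordinate in the
tube cannot in general be the parameter time (the inserted piece of the second concordance is a
surface whose level sets are not curves). This file provides the corresponding machine:

* `StripFrame.SurfaceDetour θ₀ η ε τ` — a `C^∞` map `c : ℝ × ℝ → (ℝ × ℝ) × (ℝ × ℝ)`,
  `(u, s) ↦ ((angle, time), normal coordinates)` in tube coordinates: equivariant under the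
  period in `u`, equal to the zero section `((u, s), 0)` off the arc `[θ₀ - η/8, θ₀ + η/8]`
  (mod `1`), with angle over the core strip `[θ₀ - η/4, θ₀ + η/4]` on the arc, normal part inside
  the radius `ε`, time in `[1, 2]` (resp. `(1, 2)`) when `s` is, **a product in `s` with time `s`
  for `s ≤ 1 + τ` and for `s ≥ 2 - τ`**, injective modulo the period on `ℝ × [1, 2]`, and with
  injective differential there.
* `StripFrame.Detour.toSurfaceDetour` — every detour is a surface detour (the product one), with
  the same values (`Detour.toSurfaceDetour_c`).
* `Knot.IsConicalConcordance.surfLift h w c (u, s) = tube (c (u, s))` — the modified lift: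
  smooth, periodic, equal to the old lift off the arc (`surfLift_of_not_inArc`), conical near the
  ends (`surfLift_of_le`, `surfLift_of_ge`), and, given a good tube `G`, an immersion over the
  annulus (`injective_fderiv_surfLift`), identifying exactly the period translates
  (`eq_of_surfLift_eq`: the four cases on/off the arc, by injectivity of the tube,
  `GoodTube.separated`, injectivity of the old lift and of the surface detour), with values in
  the open shell over the open annulus (`norm_surfLift_mem`).
* `surfEndCurve₁/₂`, `surfKnot₁/₂`, `surfAnnulus` and
  **`Knot.IsConicalConcordance.isConcordance_surfAnnulus`**: the descent of the new lift is a
  concordance from `surfKnot₁` to `surfKnot₂`, again conical of width `min (δ/4) τ`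
  (`isConicalConcordance_surfAnnulus`); off the arc the end knots are the old ones
  (`coe_surfKnot_circlePt_of_not_inArc`), and **if the surface detour restricts on `s = 1`
  (resp. `s = 2`) to a detour `D`, its end knot *is* `newKnot₁ D G` (resp. `newKnot₂ D G`)**
  (`surfKnot₁_eq_newKnot₁`, `surfKnot₂_eq_newKnot₂`), so that the end recognition proved for
  detours (`BandSumInTube.lean`, `BandSumConcordanceNormalRegular.lean`) applies verbatim to the
  ends of a surface replacement.

The proofs are those of `ConcordanceStripReplacement.lean`, with the time read from the detour.

## References

* R. H. Fox, J. W. Milnor, *Singularities of 2-spheres in 4-space and cobordism of knots*, Osaka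
  J. Math. 3 (1966), 257–267, §1. [FoxMilnor1966]
* M. W. Hirsch, *Differential Topology*, GTM 33 (1976), Ch. 4 §5 (tubular neighbourhoods),
  Ch. 1 §3 (injective immersions of compact manifolds are embeddings). [HirschDT1976]

## Design notes

* `SurfaceDetour` bundles the three coordinate functions into one map `c` into the domain
  `(ℝ × ℝ) × (ℝ × ℝ)` of `StripFrame.TubeSetup.tube`, so that the new lift is literally
  `tube ∘ c`; the product structure near the ends is an equation for `c (u, s)` in terms of
  `c (u, 1)`, `c (u, 2)`, from which `(c (u, 1)).1.2 = 1`, `(c (u, 2)).1.2 = 2` follow.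
* No named facts, no `sorry`; `𝔼 n`, `𝕊 n`, `𝓘₁₁` are local notation as in
  `ConcordanceStripReplacement.lean`.
-/

open scoped Manifold ContDiff Topology RealInnerProductSpace
open Function Set Metric

noncomputable section

namespace Literature.Topology.FourManifolds

/-- Local notation: `𝔼 n` is the model Euclidean space `EuclideanSpace ℝ (Fin n)`. -/
local notation "𝔼 " n:arg => EuclideanSpace ℝ (Fin n)

/-- Local notation: `𝕊 n` is the unit sphere in `EuclideanSpace ℝ (Fin (n + 1))`. -/
local notation "𝕊 " n:arg => (Metric.sphere (0 : EuclideanSpace ℝ (Fin (n + 1))) 1)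

/-- Local notation: the model with corners of `𝕊¹ × ℝ`. -/
local notation "𝓘₁₁" => (ModelWithCorners.prod (𝓡 1) 𝓘(ℝ, ℝ))

attribute [local instance] fact_finrank_euclideanSpace_two fact_finrank_euclideanSpace_four

namespace StripFrame

/-! ### Surface detours in tube coordinates -/

/-- A **surface detour** of the core strip of a good tube of angular half-width `η` and radius `ε`
along the arc `θ = θ₀`, product of width `τ` near the ends: a `C^∞` map
`c : (u, s) ↦ ((angle, time), normal coordinates)` into tube coordinates, equivariant under the
period in `u` (`c (u + 1, s) = c (u, s) + ((1, 0), 0)`), equal to the zero section `((u, s), 0)`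
off the arc `[θ₀ - η/8, θ₀ + η/8]` (mod `1`), with angle over the core strip
`[θ₀ - η/4, θ₀ + η/4]` on the arc and normal part inside the radius `ε`, with time in `[1, 2]`
(resp. `(1, 2)`) when `s ∈ [1, 2]` (resp. `(1, 2)`), equal to the product
`((angle (u, 1), s), normal (u, 1))` for `s ≤ 1 + τ` and to `((angle (u, 2), s), normal (u, 2))`
for `s ≥ 2 - τ`, injective modulo the period on `ℝ × [1, 2]` and with injective differential
there. Replacing the core strip of the annulus by `(u, s) ↦ tube (c (u, s))` produces a new
concordance (`Knot.IsConicalConcordance.isConcordance_surfAnnulus`). [folklore] -/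
structure SurfaceDetour (θ₀ η ε τ : ℝ) where
  /-- The tube coordinates `((angle, time), normal part)` of the surface. -/
  c : ℝ × ℝ → (ℝ × ℝ) × (ℝ × ℝ)
  contDiff_c : ContDiff ℝ ∞ c
  τ_pos : 0 < τ
  c_add_one : ∀ u s, c (u + 1, s) = (((c (u, s)).1.1 + 1, (c (u, s)).1.2), (c (u, s)).2)
  c_of_not_inArc : ∀ u s, ¬ InArc (θ₀ - η / 8) (θ₀ + η / 8) u → c (u, s) = ((u, s), 0)
  angle_mem : ∀ u ∈ Icc (θ₀ - η / 8) (θ₀ + η / 8), ∀ s,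
    (c (u, s)).1.1 ∈ Icc (θ₀ - η / 4) (θ₀ + η / 4)
  normal_mem : ∀ p, (c p).2 ∈ ball (0 : ℝ × ℝ) ε
  time_mem_Icc : ∀ u, ∀ s ∈ Icc (1 : ℝ) 2, (c (u, s)).1.2 ∈ Icc (1 : ℝ) 2
  time_mem_Ioo : ∀ u, ∀ s ∈ Ioo (1 : ℝ) 2, (c (u, s)).1.2 ∈ Ioo (1 : ℝ) 2
  c_of_le : ∀ u s, s ≤ 1 + τ → c (u, s) = (((c (u, 1)).1.1, s), (c (u, 1)).2)
  c_of_ge : ∀ u s, 2 - τ ≤ s → c (u, s) = (((c (u, 2)).1.1, s), (c (u, 2)).2)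
  inj : ∀ p q : ℝ × ℝ, p.2 ∈ Icc (1 : ℝ) 2 → q.2 ∈ Icc (1 : ℝ) 2 → c p = c q →
    p.2 = q.2 ∧ ∃ m : ℤ, q.1 = p.1 + m
  injective_fderiv : ∀ p : ℝ × ℝ, p.2 ∈ Icc (1 : ℝ) 2 → Injective (fderiv ℝ c p)

namespace SurfaceDetour

variable {θ₀ η ε τ : ℝ} (Dc : SurfaceDetour θ₀ η ε τ)

/-- Integer translates in the angle parameter. [folklore] -/
theorem c_add_int (u s : ℝ) (m : ℤ) :
    Dc.c (u + m, s) = (((Dc.c (u, s)).1.1 + m, (Dc.c (u, s)).1.2), (Dc.c (u, s)).2) := by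
  have hp : ∀ n : ℕ, ∀ u, Dc.c (u + n, s) =
      (((Dc.c (u, s)).1.1 + n, (Dc.c (u, s)).1.2), (Dc.c (u, s)).2) := by
    intro n
    induction n with
    | zero => intro u; simp
    | succ n ih =>
      intro u
      push_cast
      rw [← add_assoc, Dc.c_add_one, ih]
      simp only
      ring_nf
  rcases Int.eq_nat_or_neg m with ⟨n, rfl | rfl⟩
  · exact_mod_cast hp n u
  · have h1 := hp n (u + (-(n : ℤ) : ℤ))
    push_cast at h1 ⊢
    rw [show u + -(n : ℝ) + n = u by ring] at h1
    -- solve for `c (u - n, s)` from `h1`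
    have e1 : (Dc.c (u + -(n : ℝ), s)).1.1 = (Dc.c (u, s)).1.1 + -(n : ℝ) := by
      have := congrArg (fun p : (ℝ × ℝ) × (ℝ × ℝ) ↦ p.1.1) h1
      simp only at this
      linarith
    have e2 : (Dc.c (u + -(n : ℝ), s)).1.2 = (Dc.c (u, s)).1.2 := by
      have := congrArg (fun p : (ℝ × ℝ) × (ℝ × ℝ) ↦ p.1.2) h1
      simpa using this.symm
    have e3 : (Dc.c (u + -(n : ℝ), s)).2 = (Dc.c (u, s)).2 := by
      have := congrArg (fun p : (ℝ × ℝ) × (ℝ × ℝ) ↦ p.2) h1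
      simpa using this.symm
    exact Prod.ext (Prod.ext e1 e2) e3

/-- The time over `s = 1` is `1`. [folklore] -/
theorem time_one (u : ℝ) : (Dc.c (u, 1)).1.2 = 1 := by
  have := congrArg (fun p : (ℝ × ℝ) × (ℝ × ℝ) ↦ p.1.2) (Dc.c_of_le u 1 (by linarith [Dc.τ_pos]))
  simpa using this

/-- The time over `s = 2` is `2`. [folklore] -/
theorem time_two (u : ℝ) : (Dc.c (u, 2)).1.2 = 2 := by
  have := congrArg (fun p : (ℝ × ℝ) × (ℝ × ℝ) ↦ p.1.2) (Dc.c_of_ge u 2 (by linarith [Dc.τ_pos]))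
  simpa using this

/-- Over `s = 1` the coordinates are `((angle, 1), normal)`. [folklore] -/
theorem c_one (u : ℝ) : Dc.c (u, 1) = (((Dc.c (u, 1)).1.1, 1), (Dc.c (u, 1)).2) := by
  conv_lhs => rw [Dc.c_of_le u 1 (by linarith [Dc.τ_pos])]

/-- Over `s = 2` the coordinates are `((angle, 2), normal)`. [folklore] -/
theorem c_two (u : ℝ) : Dc.c (u, 2) = (((Dc.c (u, 2)).1.1, 2), (Dc.c (u, 2)).2) := by
  conv_lhs => rw [Dc.c_of_ge u 2 (by linarith [Dc.τ_pos])]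

/-- A point of the domain `(ℝ × ℝ) × (ℝ × ℝ)` in terms of its three coordinate blocks.
[folklore] -/
theorem _root_.Literature.Topology.FourManifolds.StripFrame.prod_eta₃ (p : (ℝ × ℝ) × (ℝ × ℝ)) :
    p = ((p.1.1, p.1.2), p.2) := rfl

end SurfaceDetour

/-! ### Detours are surface detours -/

namespace Detour

variable {θ₀ η ε : ℝ} (D : Detour θ₀ η ε)

/-- **A detour is a (product) surface detour**: `c (u, s) = ((κθ u, s), κd u)`, of any product
width `τ > 0`. [folklore] -/
def toSurfaceDetour {τ : ℝ} (hτ : 0 < τ) : SurfaceDetour θ₀ η ε τ where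
  c p := ((D.κθ p.1, p.2), D.κd p.1)
  contDiff_c :=
    ((D.contDiff_θ.comp contDiff_fst).prodMk contDiff_snd).prodMk (D.contDiff_d.comp contDiff_fst)
  τ_pos := hτ
  c_add_one u s := by
    simp only [D.add_one_θ, D.periodic_d u]
  c_of_not_inArc u s hu := by
    obtain ⟨h1, h2⟩ := D.id_of_not_inArc u hu
    simp [h1, h2]
  angle_mem u hu s := D.mem_of_mem u hu
  normal_mem p := D.mem_ball p.1
  time_mem_Icc u s hs := hs
  time_mem_Ioo u s hs := hs
  c_of_le u s _ := rfl
  c_of_ge u s _ := rfl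
  inj p q _ _ he := by
    simp only [Prod.mk.injEq] at he
    obtain ⟨⟨hθ, ht⟩, hd⟩ := he
    exact ⟨ht, D.inj _ _ hθ hd⟩
  injective_fderiv p _ := by
    rw [(D.hasFDerivAt_coords p).fderiv]
    exact D.injective_velL p.1

/-- The coordinates of the surface detour of a detour. [folklore] -/
@[simp]
theorem toSurfaceDetour_c {τ : ℝ} (hτ : 0 < τ) (p : ℝ × ℝ) :
    (D.toSurfaceDetour hτ).c p = ((D.κθ p.1, p.2), D.κd p.1) := rfl

end Detour

end StripFrame

namespace Knot.IsConicalConcordance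

open StripFrame

variable {K K' : Knot} {f : (𝕊 1) × ℝ → 𝔼 4} {δ : ℝ}
  (h : IsConicalConcordance K K' f δ) (w : 𝔼 4) {θ₀ η ε τ : ℝ} (Dc : SurfaceDetour θ₀ η ε τ)

/-! ### The new lift of a surface detour -/

/-- **The new lift of a surface detour**: the annulus with its core strip replaced by the surface,
read through the tube, `(u, s) ↦ tube (c (u, s))`. Off the arc it is the old lift
`annulusLift f`. [folklore] -/
def surfLift (q : ℝ × ℝ) : 𝔼 4 :=
  (h.setup w).tube (Dc.c q)

/-- Pointwise formula. [folklore] -/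
theorem surfLift_apply (u s : ℝ) : h.surfLift w Dc (u, s) = (h.setup w).tube (Dc.c (u, s)) := rfl

/-- The new lift is `C^∞`. [folklore] -/
theorem contDiff_surfLift : ContDiff ℝ ∞ (h.surfLift w Dc) :=
  (h.setup w).contDiff_tube.comp Dc.contDiff_c

/-- The new lift is `1`-periodic in `u`. [folklore] -/
theorem surfLift_add_int (u s : ℝ) (m : ℤ) : h.surfLift w Dc (u + m, s) = h.surfLift w Dc (u, s) := by
  rw [surfLift_apply, surfLift_apply, Dc.c_add_int, prod_eta₃ (Dc.c (u, s)), h.tube_add_int]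

/-- The new lift is `1`-periodic (the form used by the descent lemmas). [folklore] -/
theorem surfLift_add_one (u s : ℝ) : h.surfLift w Dc (u + 1, s) = h.surfLift w Dc (u, s) := by
  have := h.surfLift_add_int w Dc u s 1
  simpa using this

/-- **Off the arc the new lift is the old one.** [folklore] -/
theorem surfLift_of_not_inArc {u : ℝ} (hu : ¬ InArc (θ₀ - η / 8) (θ₀ + η / 8) u) (s : ℝ) :
    h.surfLift w Dc (u, s) = annulusLift f (u, s) := by
  rw [surfLift_apply, Dc.c_of_not_inArc u s hu]
  exact (h.setup w).tube_zero (u, s)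

/-- Near the inner end the new lift lies on the sphere of radius `|s|`. [folklore] -/
theorem norm_surfLift_of_le {s : ℝ} (hs : s ≤ 1 + δ / 4) (hs' : s ≤ 1 + τ) (u : ℝ) :
    ‖h.surfLift w Dc (u, s)‖ = |s| := by
  rw [surfLift_apply, Dc.c_of_le u s hs']
  exact (h.setup w).norm_tube_of_le (show s ≤ 1 + (h.setup w).δ / 4 from hs) _

/-- Near the outer end the new lift lies on the sphere of radius `|s|`. [folklore] -/
theorem norm_surfLift_of_ge {s : ℝ} (hs : 2 - δ / 4 ≤ s) (hs' : 2 - τ ≤ s) (u : ℝ) :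
    ‖h.surfLift w Dc (u, s)‖ = |s| := by
  rw [surfLift_apply, Dc.c_of_ge u s hs']
  exact (h.setup w).norm_tube_of_ge (show 2 - (h.setup w).δ / 4 ≤ s from hs) _

/-- **Near the inner end the new lift is the cone over its inner end curve**:
`surfLift (u, s) = s • surfLift (u, 1)` for `s ≤ 1 + δ/4`, `s ≤ 1 + τ`. [folklore] -/
theorem surfLift_of_le {s : ℝ} (hs : s ≤ 1 + δ / 4) (hs' : s ≤ 1 + τ) (u : ℝ) :
    h.surfLift w Dc (u, s) = s • h.surfLift w Dc (u, 1) := by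
  rw [surfLift_apply, surfLift_apply, Dc.c_of_le u s hs', Dc.c_one,
    (h.setup w).tube_of_le (show s ≤ 1 + (h.setup w).δ / 4 from hs),
    (h.setup w).tube_of_le (show (1 : ℝ) ≤ 1 + (h.setup w).δ / 4 by
      have := h.δ_pos; simp only [setup_δ]; linarith)]
  simp [TubeSetup.coneTube, TubeSetup.coneAff]

/-- **Near the outer end the new lift is the cone over its outer end curve**:
`surfLift (u, s) = (s / 2) • surfLift (u, 2)` for `s ≥ 2 - δ/4`, `s ≥ 2 - τ`. [folklore] -/
theorem surfLift_of_ge {s : ℝ} (hs : 2 - δ / 4 ≤ s) (hs' : 2 - τ ≤ s) (u : ℝ) :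
    h.surfLift w Dc (u, s) = (s / 2) • h.surfLift w Dc (u, 2) := by
  rw [surfLift_apply, surfLift_apply, Dc.c_of_ge u s hs', Dc.c_two,
    (h.setup w).tube_of_ge (show 2 - (h.setup w).δ / 4 ≤ s from hs),
    (h.setup w).tube_of_ge (show 2 - (h.setup w).δ / 4 ≤ (2 : ℝ) by
      have := h.δ_pos; simp only [setup_δ]; linarith)]
  simp only [TubeSetup.coneTube, TubeSetup.coneAff, smul_smul]
  congr 1
  ring

/-! ### The derivative of the new lift -/

/-- The new lift has derivative `D(tube) ∘ D(c)`. [folklore] -/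
theorem hasFDerivAt_surfLift (q : ℝ × ℝ) :
    HasFDerivAt (h.surfLift w Dc)
      ((fderiv ℝ (h.setup w).tube (Dc.c q)).comp (fderiv ℝ Dc.c q)) q :=
  (((h.setup w).contDiff_tube.differentiable (by simp)) _).hasFDerivAt.comp q
    ((Dc.contDiff_c.differentiable (by simp)) q).hasFDerivAt

variable {w Dc}

/-- **The new lift is an immersion over the annulus `1 ≤ s ≤ 2`**, given a good tube: off the arc
it is the old lift (an immersion), on the arc the tube has injective derivative and the surface
detour has injective derivative. [folklore] -/
theorem injective_fderiv_surfLift (G : (h.setup w).GoodTube θ₀ η ε) (u : ℝ) {s : ℝ}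
    (hs : s ∈ Icc (1 : ℝ) 2) : Injective (fderiv ℝ (h.surfLift w Dc) (u, s)) := by
  have hδ := h.δ_pos
  by_cases hu : InArc (θ₀ - η / 8) (θ₀ + η / 8) u
  · -- on the arc: reduce to the period window
    obtain ⟨m, hm⟩ := inArc_iff.1 hu
    have hper : h.surfLift w Dc = fun q ↦ h.surfLift w Dc (q + (-(m : ℝ), 0)) := by
      funext q
      obtain ⟨v, s⟩ := q
      show h.surfLift w Dc (v, s) = h.surfLift w Dc (v + -(m : ℝ), s + 0)
      rw [add_zero, show v + -(m : ℝ) = v + ((-m : ℤ) : ℝ) by push_cast; ring, h.surfLift_add_int]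
    rw [hper, fderiv_comp_add_right]
    simp only [Prod.mk_add_mk, add_zero]
    rw [(h.hasFDerivAt_surfLift w Dc (u + -(m : ℝ), s)).fderiv, ContinuousLinearMap.coe_comp]
    have e : u + -(m : ℝ) = u - m := by ring
    simp only [e]
    refine Injective.comp ?_ (Dc.injective_fderiv (u - m, s) hs)
    have hθ := Dc.angle_mem (u - m) hm s
    have ht := Dc.time_mem_Icc (u - m) s hs
    refine G.injective_fderiv (Dc.c (u - m, s)) ?_
    rw [prod_eta₃ (Dc.c (u - m, s))]
    exact mk_mem_prod (mk_mem_prod ⟨by linarith [hθ.1, G.η_pos], by linarith [hθ.2, G.η_pos]⟩ ht)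
      (Dc.normal_mem _)
  · -- off the arc: locally the old lift
    have hev : h.surfLift w Dc =ᶠ[𝓝 (u, s)] annulusLift f := by
      have hO : IsOpen {q : ℝ × ℝ | ¬ InArc (θ₀ - η / 8) (θ₀ + η / 8) q.1} :=
        (isClosed_setOf_inArc _ _).isOpen_compl.preimage continuous_fst
      filter_upwards [hO.mem_nhds hu] with q hq
      obtain ⟨v, s⟩ := q
      exact h.surfLift_of_not_inArc w Dc hq s
    rw [hev.fderiv_eq]
    exact h.injective_fderiv_annulusLift u ⟨by linarith [hs.1], by linarith [hs.2]⟩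

/-- **The new lift identifies exactly the period translates over the annulus `1 ≤ s ≤ 2`**,
given a good tube (separation of the tube from the far sheet of the annulus, injectivity of the
tube, injectivity of the old lift and of the surface detour modulo the period). [folklore] -/
theorem eq_of_surfLift_eq (G : (h.setup w).GoodTube θ₀ η ε) {u s u' s' : ℝ}
    (hs : s ∈ Icc (1 : ℝ) 2) (hs' : s' ∈ Icc (1 : ℝ) 2)
    (he : h.surfLift w Dc (u, s) = h.surfLift w Dc (u', s')) : s = s' ∧ ∃ m : ℤ, u' = u + m := by
  -- a point of the arc, read in the window, gives tube data over the core strip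
  have key : ∀ {u : ℝ} {m : ℤ}, u - m ∈ Icc (θ₀ - η / 8) (θ₀ + η / 8) → ∀ s : ℝ,
      h.surfLift w Dc (u, s) = (h.setup w).tube (Dc.c (u - m, s)) ∧
      (Dc.c (u - m, s)).1.1 ∈ Icc (θ₀ - η / 4) (θ₀ + η / 4) := by
    intro u m hm s
    refine ⟨?_, Dc.angle_mem _ hm s⟩
    rw [show u = (u - m) + (m : ℝ) by ring, h.surfLift_add_int, surfLift_apply]
    simp
  have hcoreT : ∀ {θ : ℝ}, θ ∈ Icc (θ₀ - η / 4) (θ₀ + η / 4) → θ ∈ Icc (θ₀ - η) (θ₀ + η) :=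
    fun hθ ↦ ⟨by linarith [hθ.1, G.η_pos], by linarith [hθ.2, G.η_pos]⟩
  by_cases hu : InArc (θ₀ - η / 8) (θ₀ + η / 8) u <;>
    by_cases hu' : InArc (θ₀ - η / 8) (θ₀ + η / 8) u'
  · -- both on the arc: injectivity of the tube and of the surface detour
    obtain ⟨m, hm⟩ := inArc_iff.1 hu
    obtain ⟨m', hm'⟩ := inArc_iff.1 hu'
    obtain ⟨e1, hq1⟩ := key hm s
    obtain ⟨e2, hq2⟩ := key hm' s'
    rw [e1, e2] at he
    have h1 : Dc.c (u - m, s) ∈ (Icc (θ₀ - η) (θ₀ + η) ×ˢ Icc (1 : ℝ) 2) ×ˢ ball (0 : ℝ × ℝ) ε := by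
      rw [prod_eta₃ (Dc.c (u - m, s))]
      exact ⟨mk_mem_prod (hcoreT hq1) (Dc.time_mem_Icc _ s hs), Dc.normal_mem _⟩
    have h2 : Dc.c (u' - m', s') ∈ (Icc (θ₀ - η) (θ₀ + η) ×ˢ Icc (1 : ℝ) 2) ×ˢ ball (0 : ℝ × ℝ) ε := by
      rw [prod_eta₃ (Dc.c (u' - m', s'))]
      exact ⟨mk_mem_prod (hcoreT hq2) (Dc.time_mem_Icc _ s' hs'), Dc.normal_mem _⟩
    have hcc := G.injOn h1 h2 he
    obtain ⟨hss, n, hn⟩ := Dc.inj (u - m, s) (u' - m', s') hs hs' hcc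
    exact ⟨hss, n + m' - m, by simp only at hn; push_cast; linarith⟩
  · -- `u` on the arc, `u'` off: separation
    obtain ⟨m, hm⟩ := inArc_iff.1 hu
    obtain ⟨e1, hq1⟩ := key hm s
    rw [e1, h.surfLift_of_not_inArc w Dc hu' s', prod_eta₃ (Dc.c (u - m, s))] at he
    obtain ⟨hd0, htt, n, hn⟩ := G.separated _ (mk_mem_prod hq1 (Dc.time_mem_Icc _ s hs)) _
      (Dc.normal_mem _) u' s' hs' he
    simp only at htt hn
    -- `u'` off the arc is the zero section; compare with the surface at `(u - m + n, s)`
    have hc' : Dc.c (u', s') = ((u', s'), 0) := Dc.c_of_not_inArc u' s' hu'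
    have hcc : Dc.c (u - m + n, s) = Dc.c (u', s') := by
      rw [hc', show u - m + (n : ℝ) = (u - m) + (n : ℝ) from rfl, Dc.c_add_int, ← hn, ← htt, hd0]
    obtain ⟨hss, n', hn'⟩ := Dc.inj (u - m + n, s) (u', s') hs hs' hcc
    exact ⟨hss, n + n' - m, by simp only at hn'; rw [hn']; push_cast; ring⟩
  · -- `u` off the arc, `u'` on: separation, symmetric
    obtain ⟨m, hm⟩ := inArc_iff.1 hu'
    obtain ⟨e1, hq1⟩ := key hm s'
    rw [e1, h.surfLift_of_not_inArc w Dc hu s, prod_eta₃ (Dc.c (u' - m, s'))] at he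
    obtain ⟨hd0, htt, n, hn⟩ :=
      G.separated _ (mk_mem_prod hq1 (Dc.time_mem_Icc _ s' hs')) _ (Dc.normal_mem _) u s hs he.symm
    simp only at htt hn
    have hc' : Dc.c (u, s) = ((u, s), 0) := Dc.c_of_not_inArc u s hu
    have hcc : Dc.c (u' - m + n, s') = Dc.c (u, s) := by
      rw [hc', show u' - m + (n : ℝ) = (u' - m) + (n : ℝ) from rfl, Dc.c_add_int, ← hn, ← htt, hd0]
    obtain ⟨hss, n', hn'⟩ := Dc.inj (u' - m + n, s') (u, s) hs' hs hcc
    exact ⟨hss.symm, m - n - n', by simp only at hn'; push_cast; linarith⟩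
  · -- both off the arc: the old lift
    rw [h.surfLift_of_not_inArc w Dc hu s, h.surfLift_of_not_inArc w Dc hu' s'] at he
    exact h.exists_int_of_F_eq hs hs' he

/-- **Over the open annulus the new lift stays in the open shell.** [folklore] -/
theorem norm_surfLift_mem (G : (h.setup w).GoodTube θ₀ η ε) (u : ℝ) {s : ℝ} (hs : s ∈ Ioo (1 : ℝ) 2) :
    1 < ‖h.surfLift w Dc (u, s)‖ ∧ ‖h.surfLift w Dc (u, s)‖ < 2 := by
  by_cases hu : InArc (θ₀ - η / 8) (θ₀ + η / 8) u
  · obtain ⟨m, hm⟩ := inArc_iff.1 hu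
    rw [show u = (u - m) + (m : ℝ) by ring, h.surfLift_add_int, surfLift_apply,
      prod_eta₃ (Dc.c (u - m, s))]
    have hθ := Dc.angle_mem _ hm s
    exact G.norm_mem _ (mk_mem_prod ⟨by linarith [hθ.1, G.η_pos], by linarith [hθ.2, G.η_pos]⟩
      (Dc.time_mem_Ioo _ s hs)) _ (Dc.normal_mem _)
  · rw [h.surfLift_of_not_inArc w Dc hu s, annulusLift_apply]
    exact h.isConcordance.2.2.2.1 (circlePt u) s hs

/-! ### The end curves of the new lift -/

variable (w Dc)

/-- The **inner end curve** of the new lift, in the `2π`-periodic parametrisation of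
`KnotOfClosedCurve.lean`: `θ ↦ surfLift (θ / 2π, 1)`. [folklore] -/
def surfEndCurve₁ (θ : ℝ) : 𝔼 4 :=
  h.surfLift w Dc (θ / (2 * Real.pi), 1)

/-- The **outer end curve** of the new lift, rescaled to the unit sphere:
`θ ↦ ½ • surfLift (θ / 2π, 2)`. [folklore] -/
def surfEndCurve₂ (θ : ℝ) : 𝔼 4 :=
  (1 / 2 : ℝ) • h.surfLift w Dc (θ / (2 * Real.pi), 2)

/-- The velocity of the inner end curve. [folklore] -/
theorem hasDerivAt_surfEndCurve₁ (θ : ℝ) :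
    HasDerivAt (h.surfEndCurve₁ w Dc)
      (fderiv ℝ (h.surfLift w Dc) (θ / (2 * Real.pi), 1) ((1 / (2 * Real.pi), 0) : ℝ × ℝ)) θ :=
  (((h.contDiff_surfLift w Dc).differentiable (by simp)) _).hasFDerivAt.comp_hasDerivAt θ
    (hasDerivAt_param 1 θ)

/-- The velocity of the outer end curve. [folklore] -/
theorem hasDerivAt_surfEndCurve₂ (θ : ℝ) :
    HasDerivAt (h.surfEndCurve₂ w Dc)
      ((1 / 2 : ℝ) • fderiv ℝ (h.surfLift w Dc) (θ / (2 * Real.pi), 2)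
        ((1 / (2 * Real.pi), 0) : ℝ × ℝ)) θ :=
  ((((h.contDiff_surfLift w Dc).differentiable (by simp)) _).hasFDerivAt.comp_hasDerivAt θ
    (hasDerivAt_param 2 θ)).const_smul (1 / 2 : ℝ)

variable {w}

/-- **The inner end curve is a regular closed curve on `𝕊³`** (given a good tube). [folklore] -/
theorem isRegularClosedCurve_surfEndCurve₁ (G : (h.setup w).GoodTube θ₀ η ε) :
    IsRegularClosedCurve (h.surfEndCurve₁ w Dc) where
  contDiff := (h.contDiff_surfLift w Dc).comp
    ((contDiff_id.div_const _).prodMk contDiff_const)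
  periodic θ := by
    simp only [surfEndCurve₁]
    rw [add_div, div_self (by positivity)]
    exact h.surfLift_add_one w Dc _ 1
  norm_eq_one θ := by
    simp only [surfEndCurve₁]
    rw [h.norm_surfLift_of_le w Dc (by linarith [h.δ_pos]) (by linarith [Dc.τ_pos]), abs_one]
  deriv_ne_zero θ := by
    rw [(h.hasDerivAt_surfEndCurve₁ w Dc θ).deriv]
    intro h0
    have := (injective_iff_map_eq_zero _).1 (h.injective_fderiv_surfLift G _ ⟨le_rfl, by norm_num⟩)
      _ h0
    simp [Real.pi_ne_zero] at this

/-- **The outer end curve is a regular closed curve on `𝕊³`** (given a good tube). [folklore] -/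
theorem isRegularClosedCurve_surfEndCurve₂ (G : (h.setup w).GoodTube θ₀ η ε) :
    IsRegularClosedCurve (h.surfEndCurve₂ w Dc) where
  contDiff := by
    have h1 : ContDiff ℝ ∞ fun θ : ℝ ↦ h.surfLift w Dc (θ / (2 * Real.pi), 2) :=
      (h.contDiff_surfLift w Dc).comp ((contDiff_id.div_const _).prodMk contDiff_const)
    exact (contDiff_const (c := (1 / 2 : ℝ))).smul h1
  periodic θ := by
    simp only [surfEndCurve₂]
    rw [add_div, div_self (by positivity), h.surfLift_add_one]
  norm_eq_one θ := by
    simp only [surfEndCurve₂]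
    rw [norm_smul, h.norm_surfLift_of_ge w Dc (by linarith [h.δ_pos]) (by linarith [Dc.τ_pos])]
    norm_num
  deriv_ne_zero θ := by
    rw [(h.hasDerivAt_surfEndCurve₂ w Dc θ).deriv]
    intro h0
    have h0' := (smul_eq_zero.1 h0).resolve_left (by norm_num)
    have := (injective_iff_map_eq_zero _).1
      (h.injective_fderiv_surfLift G _ ⟨by norm_num, le_rfl⟩) _ h0'
    simp [Real.pi_ne_zero] at this

/-- Equal values of the new lift at times in `[1, 2]` force equal times and equal points of the
circle in the `2π`-parametrisation. [folklore] -/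
theorem circlePoint_eq_of_surfLift_eq (G : (h.setup w).GoodTube θ₀ η ε) {s : ℝ}
    (hs : s ∈ Icc (1 : ℝ) 2) {a a' : ℝ}
    (he : h.surfLift w Dc (a / (2 * Real.pi), s) = h.surfLift w Dc (a' / (2 * Real.pi), s)) :
    circlePoint a = circlePoint a' := by
  obtain ⟨-, m, hm⟩ := h.eq_of_surfLift_eq G hs hs he
  have ha' : a' = a + m * (2 * Real.pi) := by
    have h2 : (0 : ℝ) < 2 * Real.pi := by positivity
    field_simp at hm
    linarith
  rw [ha']
  exact ((periodic_circlePoint.int_mul m) a).symm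

/-- The inner end curve is injective modulo `2π`. [folklore] -/
theorem surfEndCurve₁_inj (G : (h.setup w).GoodTube θ₀ η ε) (a a' : ℝ)
    (he : h.surfEndCurve₁ w Dc a = h.surfEndCurve₁ w Dc a') : circlePoint a = circlePoint a' :=
  h.circlePoint_eq_of_surfLift_eq Dc G ⟨le_rfl, by norm_num⟩ he

/-- The outer end curve is injective modulo `2π`. [folklore] -/
theorem surfEndCurve₂_inj (G : (h.setup w).GoodTube θ₀ η ε) (a a' : ℝ)
    (he : h.surfEndCurve₂ w Dc a = h.surfEndCurve₂ w Dc a') : circlePoint a = circlePoint a' :=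
  h.circlePoint_eq_of_surfLift_eq Dc G ⟨by norm_num, le_rfl⟩
    (smul_right_injective (𝔼 4) (by norm_num : (1 / 2 : ℝ) ≠ 0) he)

/-- **The inner end knot** of the new lift of a surface detour (`IsRegularClosedCurve.toKnot`).
[folklore] -/
def surfKnot₁ (G : (h.setup w).GoodTube θ₀ η ε) : Knot :=
  (h.isRegularClosedCurve_surfEndCurve₁ Dc G).toKnot (h.surfEndCurve₁_inj Dc G)

/-- **The outer end knot** of the new lift of a surface detour. [folklore] -/
def surfKnot₂ (G : (h.setup w).GoodTube θ₀ η ε) : Knot :=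
  (h.isRegularClosedCurve_surfEndCurve₂ Dc G).toKnot (h.surfEndCurve₂_inj Dc G)

/-- The inner end knot passes through `surfLift (θ / 2π, 1)` at `circlePoint θ`. [folklore] -/
theorem coe_surfKnot₁_circlePoint (G : (h.setup w).GoodTube θ₀ η ε) (θ : ℝ) :
    ((h.surfKnot₁ Dc G (circlePoint θ) : 𝕊 3) : 𝔼 4) = h.surfLift w Dc (θ / (2 * Real.pi), 1) :=
  (h.isRegularClosedCurve_surfEndCurve₁ Dc G).coe_toKnot_circlePoint _ θ

/-- The outer end knot passes through `½ • surfLift (θ / 2π, 2)` at `circlePoint θ`.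
[folklore] -/
theorem coe_surfKnot₂_circlePoint (G : (h.setup w).GoodTube θ₀ η ε) (θ : ℝ) :
    ((h.surfKnot₂ Dc G (circlePoint θ) : 𝕊 3) : 𝔼 4) =
      (1 / 2 : ℝ) • h.surfLift w Dc (θ / (2 * Real.pi), 2) :=
  (h.isRegularClosedCurve_surfEndCurve₂ Dc G).coe_toKnot_circlePoint _ θ

/-! ### The new concordance -/

variable (w)

/-- **The new annulus** on `𝕊¹ × ℝ`: the descent of the new lift of the surface detour.
[folklore] -/
def surfAnnulus : (𝕊 1) × ℝ → 𝔼 4 :=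
  descend (h.surfLift w Dc)

/-- The new annulus in the angle coordinate `angA`. [folklore] -/
theorem surfAnnulus_apply (x : 𝕊 1) (s : ℝ) :
    h.surfAnnulus w Dc (x, s) = h.surfLift w Dc (angA x, s) := rfl

/-- The new annulus over `circlePoint θ`. [folklore] -/
theorem surfAnnulus_circlePoint (θ s : ℝ) :
    h.surfAnnulus w Dc (circlePoint θ, s) = h.surfLift w Dc (θ / (2 * Real.pi), s) := by
  rw [circlePoint_eq_circlePt_div]
  exact descend_circlePt (h.surfLift_add_one w Dc) _ _

variable {w}

/-- **Replacing a strip of a conical concordance by a surface detour inside a good tube yields a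
concordance** between the new end knots (as `isConcordance_newAnnulus`, with the time read from
the detour). Fox–Milnor (1966), §1 (the carrying construction behind "the cobordism class of
`k₁ # k₂` depends only on the classes of the factors", here in the form needed when both factors
move). [cite: FoxMilnor1966, §1] -/
theorem isConcordance_surfAnnulus (G : (h.setup w).GoodTube θ₀ η ε) :
    IsConcordance (h.surfKnot₁ Dc G) (h.surfKnot₂ Dc G) (h.surfAnnulus w Dc) := by
  have hδ := h.δ_pos
  have hτ := Dc.τ_pos
  have hper := h.surfLift_add_one w Dc
  refine ⟨contMDiff_descend (h.contDiff_surfLift w Dc) hper, ?_, ?_, ?_, ?_, ?_, ?_⟩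
  · -- injectivity on the annulus
    rintro ⟨x, s⟩ ⟨-, hs⟩ ⟨x', s'⟩ ⟨-, hs'⟩ he
    rw [surfAnnulus_apply, surfAnnulus_apply] at he
    obtain ⟨hss, m, hm⟩ := h.eq_of_surfLift_eq G hs hs' he
    have hx : x' = x := by
      rw [← circlePt_angA x', hm, circlePt_add_int, circlePt_angA]
    rw [hx]
    exact Prod.ext rfl hss
  · -- immersion on the annulus
    rintro ⟨x, s⟩ ⟨-, hs⟩
    exact mfderiv_descend_injective (h.contDiff_surfLift w Dc) hper
      fun u _ ↦ h.injective_fderiv_surfLift G u hs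
  · -- the open annulus goes into the open shell
    intro x s hs
    rw [surfAnnulus_apply]
    exact h.norm_surfLift_mem G _ hs
  · -- neatness: the ends are cones
    intro x
    constructor
    · have hev : (fun s ↦ ‖h.surfAnnulus w Dc (x, s)‖ ^ 2) =ᶠ[𝓝 1] fun s ↦ s ^ 2 := by
        filter_upwards [Ioo_mem_nhds (by norm_num : (0 : ℝ) < 1)
          (lt_min (by linarith : (1 : ℝ) < 1 + δ / 4) (by linarith : (1 : ℝ) < 1 + τ))] with s hs
        rw [surfAnnulus_apply, h.norm_surfLift_of_le w Dc (hs.2.le.trans (min_le_left _ _))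
          (hs.2.le.trans (min_le_right _ _)), sq_abs]
      rw [hev.deriv_eq]
      norm_num
    · have hev : (fun s ↦ ‖h.surfAnnulus w Dc (x, s)‖ ^ 2) =ᶠ[𝓝 2] fun s ↦ s ^ 2 := by
        filter_upwards [Ioi_mem_nhds (max_lt (by linarith : (2 : ℝ) - δ / 4 < 2)
          (by linarith : (2 : ℝ) - τ < 2))] with s hs
        rw [surfAnnulus_apply, h.norm_surfLift_of_ge w Dc (le_of_lt ((le_max_left _ _).trans_lt hs))
          (le_of_lt ((le_max_right _ _).trans_lt hs)), sq_abs]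
      rw [hev.deriv_eq]
      norm_num
  · -- the inner end is the inner end knot
    intro x
    obtain ⟨θ, rfl⟩ := circlePoint_surjective x
    rw [surfAnnulus_circlePoint, coe_surfKnot₁_circlePoint]
  · -- the outer end is twice the outer end knot
    intro x
    obtain ⟨θ, rfl⟩ := circlePoint_surjective x
    rw [surfAnnulus_circlePoint, coe_surfKnot₂_circlePoint, smul_smul]
    norm_num

/-- **The new concordance is again conical**, of width `min (δ/4) τ`: near the ends the new lift is
the cone over its end curves (`surfLift_of_le`, `surfLift_of_ge`). [folklore] -/
theorem isConicalConcordance_surfAnnulus (G : (h.setup w).GoodTube θ₀ η ε) :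
    IsConicalConcordance (h.surfKnot₁ Dc G) (h.surfKnot₂ Dc G) (h.surfAnnulus w Dc)
      (min (δ / 4) τ) where
  isConcordance := h.isConcordance_surfAnnulus Dc G
  δ_pos := lt_min (by linarith [h.δ_pos]) Dc.τ_pos
  δ_le := (min_le_left _ _).trans (by linarith [h.δ_le])
  cone₁ x s hs := by
    obtain ⟨θ, rfl⟩ := circlePoint_surjective x
    rw [surfAnnulus_circlePoint, coe_surfKnot₁_circlePoint,
      h.surfLift_of_le w Dc (by linarith [min_le_left (δ / 4) τ])
        (by linarith [min_le_right (δ / 4) τ])]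
  cone₂ x s hs := by
    obtain ⟨θ, rfl⟩ := circlePoint_surjective x
    rw [surfAnnulus_circlePoint, coe_surfKnot₂_circlePoint,
      h.surfLift_of_ge w Dc (by linarith [min_le_left (δ / 4) τ])
        (by linarith [min_le_right (δ / 4) τ]), smul_smul]
    congr 1
    ring

/-- **Off the arc the new end knots agree with the old ones**: at `circlePt u` with `u` off the
arc, `surfKnot₁ = K` and `surfKnot₂ = K'` (as points of `ℝ⁴`). [folklore] -/
theorem coe_surfKnot_circlePt_of_not_inArc (G : (h.setup w).GoodTube θ₀ η ε) {u : ℝ}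
    (hu : ¬ InArc (θ₀ - η / 8) (θ₀ + η / 8) u) :
    ((h.surfKnot₁ Dc G (circlePt u) : 𝕊 3) : 𝔼 4) = K (circlePt u) ∧
      ((h.surfKnot₂ Dc G (circlePt u) : 𝕊 3) : 𝔼 4) = K' (circlePt u) := by
  have e : circlePt u = circlePoint (2 * Real.pi * u) := rfl
  constructor
  · rw [e, coe_surfKnot₁_circlePoint, mul_div_cancel_left₀ _ (by positivity),
      h.surfLift_of_not_inArc w Dc hu, annulusLift_apply, h.cone₁ _ 1 (by linarith [h.δ_pos]),
      one_smul, ← e]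
  · rw [e, coe_surfKnot₂_circlePoint, mul_div_cancel_left₀ _ (by positivity),
      h.surfLift_of_not_inArc w Dc hu, annulusLift_apply, h.cone₂ _ 2 (by linarith [h.δ_pos]),
      smul_smul, ← e]
    norm_num

/-! ### Surface detours restricting to detours at the ends -/

/-- **If the surface detour is the detour `D` over `s = 1`, the inner end knot is `newKnot₁ D G`**
(the knots of two regular closed curves with the same values coincide). This lets the end
recognition proved for detours apply to the ends of a surface replacement. [folklore] -/
theorem surfKnot₁_eq_newKnot₁ (G : (h.setup w).GoodTube θ₀ η ε) (D : Detour θ₀ η ε)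
    (hD : ∀ u, Dc.c (u, 1) = ((D.κθ u, 1), D.κd u)) : h.surfKnot₁ Dc G = h.newKnot₁ D G := by
  apply SphereEmbedding.ext
  funext x
  obtain ⟨θ, rfl⟩ := circlePoint_surjective x
  apply Subtype.ext
  show ((h.surfKnot₁ Dc G (circlePoint θ) : 𝕊 3) : 𝔼 4) = ((h.newKnot₁ D G (circlePoint θ) : 𝕊 3) : 𝔼 4)
  rw [coe_surfKnot₁_circlePoint, coe_newKnot₁_circlePoint, surfLift_apply, newLift_apply, hD]

/-- **If the surface detour is the detour `D` over `s = 2`, the outer end knot is `newKnot₂ D G`.**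
[folklore] -/
theorem surfKnot₂_eq_newKnot₂ (G : (h.setup w).GoodTube θ₀ η ε) (D : Detour θ₀ η ε)
    (hD : ∀ u, Dc.c (u, 2) = ((D.κθ u, 2), D.κd u)) : h.surfKnot₂ Dc G = h.newKnot₂ D G := by
  apply SphereEmbedding.ext
  funext x
  obtain ⟨θ, rfl⟩ := circlePoint_surjective x
  apply Subtype.ext
  show ((h.surfKnot₂ Dc G (circlePoint θ) : 𝕊 3) : 𝔼 4) = ((h.newKnot₂ D G (circlePoint θ) : 𝕊 3) : 𝔼 4)
  rw [coe_surfKnot₂_circlePoint, coe_newKnot₂_circlePoint, surfLift_apply, newLift_apply, hD]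

/-- **The surface replacement of the product surface detour of a detour `D` is the replacement by
`D`**: same lift (`surfLift h w (D.toSurfaceDetour hτ) = newLift h w D`). [folklore] -/
theorem surfLift_toSurfaceDetour (D : Detour θ₀ η ε) (hτ : 0 < τ) :
    h.surfLift w (D.toSurfaceDetour hτ) = h.newLift w D := by
  funext q
  obtain ⟨u, s⟩ := q
  rw [surfLift_apply, newLift_apply, Detour.toSurfaceDetour_c]

/-- The end knots of the product surface detour of `D` are those of `D`. [folklore] -/
theorem surfKnot_toSurfaceDetour (G : (h.setup w).GoodTube θ₀ η ε) (D : Detour θ₀ η ε) (hτ : 0 < τ) :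
    h.surfKnot₁ (D.toSurfaceDetour hτ) G = h.newKnot₁ D G ∧
      h.surfKnot₂ (D.toSurfaceDetour hτ) G = h.newKnot₂ D G :=
  ⟨h.surfKnot₁_eq_newKnot₁ _ G D fun _ ↦ rfl, h.surfKnot₂_eq_newKnot₂ _ G D fun _ ↦ rfl⟩

end Knot.IsConicalConcordance

end Literature.Topology.FourManifolds
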